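import Summits.QuantumFields.YangMills.Theorems.LuscherReductionTwistedTraceScalingBTRecord
import Summits.QuantumFields.YangMills.Theorems.LuscherReductionTwistedTraceScalingOneSiteNearTop
import Summits.QuantumFields.YangMills.Theorems.LuscherReductionOneSiteLevelsAbsUpperSeam
import HarnessLib

/-!
# R41 — SLOW-FACTOR DOMINANCE NECESSITY for the stiff brick (B-ST) of record: `hST(btOmega, btSlow, θ₀)` forces `btSlow ≥ (1 − o(1))·σ'/(1 − θ₀)` against EVERY
# (B-T)-certified fibre profile `Ω'` disjoint from `btOmega`; a certified competitor with `σ' ≥ btSlow` makes (B-ST) unsatisfiable for every `θ₀ > 0` and every fat factor `M ≥ 1`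
(crux `LuscherReduction.TwistedTraceScaling`, stmt-QuantumFields-20203, skeleton «twolattice» rev 3, stub S-BASE, sub-target C4-CORE; standing disprover, cycle 34;
`Cruxes/TwistedTraceScaling/Disproof.lean` §AM / VERDICT 34, Annex B §V1n; vets lane A g15's `…BTRecord` (tree 2026-08-28) — the TYPED (B-ST) hypothesis `hST` of
`recordAnalyticInput_of_stiff_offDiag` / `innerNoIntruderOneOrbitAt_of_stiff_offDiag` with `Ω := btOmega L`, `σ := btSlow L`)

Lane A's `…BTRecord.recordAnalyticInput_of_stiff_offDiag` discharges every field of `RecordAnalyticInput L s M` from the profile of record `btOmega L = frozenProfile L 0 btRad`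
(FLAT on the fibre ball `‖x‖ ≤ btRad β = min (1/40) β^{-1/2}`) and its slow factor `btSlow L β = btConst/fpZ/recordGamma`, EXCEPT the stiff domination
  (B-ST) `hST : ∀ᶠ β, ∀ v` admissible (`supp v ⊆ supp recordChi L s 43 M β`) and FIBREWISE `w`-orthogonal to `btOmega L β`,
        `tubeForm β v ≤ (1 − θ₀)·(btSlow L β · λ₀(L³β))·‖v‖²_w`, `w = softWeight (recordChi L s 43 M β)`, with a FIXED `θ₀ ∈ (0, 1]`,
and the off-diagonal brick (B-OD).  This file proves what (B-ST) COSTS, for the specific pair `(btOmega, btSlow)`, in the record's own currency and with no model input: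

* §1 scalar endgame (`slow_ratio_le`, `slow_ratio_clean`, `no_gap_of_dominance`).
* §2 fibre lemmas: ★ `fibreInner_boFun_eq_zero_of_disjoint` — a BO function `boFun φ Ω'` on a profile `Ω'` with `Ω'·Ω ≡ 0` is fibrewise `w`-orthogonal to `Ω` for EVERY weight
  `w` and amplitude `φ` (so it is a legal test state of `hST`); ★ `fibreMass_le_of_gaugeAvg_le` — the ONE-SIDED fibre-mass brick (from `…FibreMassBrick.fibreMass_brick` at `κ = 1`);
  ★ `gaugeAvg_recordChi_le` — the upper half of (P) (`…FPWeightCore.fpWeight_core_constant`) holds at EVERY fat factor `M` (monotonicity of `recordChi` in `M`,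
  `recordChi_mono`), whence ★ `fibreMass_recordChi_le` / `tubeNormSq_boFun_le`: `‖boFun φ Ω'‖²_w ≤ (1 + Cβ^{-2s}·43²)·recordGamma L Ω' β·‖φ‖²` for window amplitudes `φ`.
* §3 ★★★ `btSlow_dominates_of_stiff_gap` — THE NECESSITY.  Let `Ω'` be any fibre profile family, measurable, `|Ω'| ≤ 1`, supported in `{‖x‖ ≤ R' β}`, `R' ≤ 1/2`,
  `12|Site|R' < β^{-s}` eventually, DISJOINT from the record profile (`Ω' β x ≠ 0 → btOmega L β x = 0`), `recordGamma L Ω' β > 0`, with a ONE-SIDED (B-T) certificate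
  `T_β(boFun φ Ω'_β) ≥ σ'γ'·Q_{L³β}(φ) − κ'σ'γ'·(Q + λ₀‖φ‖²)` on the window `{orbitDist < recordDelta1 L s β}` (the lower half of lane A's `hT` shape; `hT_lower_of_twoSided`),
  `σ' > 0`, `κ' → 0`.  If `hST(btOmega, btSlow, θ₀, M)` holds for some `M ≥ 1`, `θ₀ ≤ 1`, then for every `ε > 0`, eventually
        `(1 − ε)·σ' β ≤ (1 − θ₀)·(1 + ε)·btSlow L β`.
  Proof: test `hST` on `v = boFun φ₀ Ω'_β`, `φ₀` the localized near-top one-site amplitude of `…OneSiteNearTop.exists_localized_near_top` at `B = L³β`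
  (`Q(φ₀) ≥ e^{−ελ_b}λ₀‖φ₀‖²`, support `13B^{-1/5} < recordDelta1`, `core_lt_recordDelta1`, `s < 1/5`): admissible by `boFun_support_record`, orthogonal by §2, and
  `σ'γ'[(1−κ')e^{−ελ_b} − κ']λ₀‖φ₀‖² ≤ T(v) ≤ (1−θ₀)btSlow·λ₀·‖v‖²_w ≤ (1−θ₀)(1+κ_N)btSlow·γ'λ₀‖φ₀‖²`.
* §4 ★★★ `btStiffGap_false_of_competitor` — if moreover `btSlow L β ≤ D·σ' β` eventually with `(1 − θ₀)·D < 1`, then `hST(btOmega, btSlow, θ₀, M)` is FALSE for every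
  `M ≥ 1`; ★★★ `btStiffGap_false_of_dominant_competitor` (`D = 1`): a certified disjoint competitor with `σ' ≥ btSlow` eventually refutes lane A's `hST` for EVERY
  `θ₀ ∈ (0, 1]` and EVERY `M ≥ 1` — i.e. the hypothesis `hST` of `…BTRecord.recordAnalyticInput_of_stiff_offDiag` / `innerNoIntruderOneOrbitAt_of_stiff_offDiag` cannot be
  supplied (for any `M`, in particular for the `M ≥ M₀` these theorems ask for).

READING (paper; the Born–Oppenheimer fibre model of record — scaled fibre coordinate `y = β^{1/2}x`, `D = 6L³ − 6` transverse modes with `ω² ∈ {4, 8, 12}`, Mehler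
ground amplitude `g = Πe^{−b_k y_k²}`, `b_k = √(a_k² + 2a_k)`, `a_k = ω_k²/2`; see R40 `…Negative.StiffCaptureNecessity` and Disproof.lean VERDICT 33/34).  Up to the
`Ω`-independent factors `fpZ` and the vacuum core kernel, `σ = C(Ω)/fpZ/γ(Ω)` is the FIBRE RAYLEIGH QUOTIENT `⟨Ω, K_fibre Ω⟩/⟨Ω, Ω⟩_W` of the profile, and (B-T) with
`σ' = C(Ω')/fpZ/γ(Ω')` is produced for any reasonable profile by the same engine (`…BTFixedBeta.fixed_beta_estimate` is profile-agnostic; only the rate schedule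
`…BTRatesAtoms/Core/Budget` is written for `βR² ≤ 1`).  §4 therefore says: **(B-ST) for `btOmega` with gap `θ₀` requires the flat unit-ball profile to beat the fibre
quotient of EVERY profile supported outside its ball by the factor `1/(1 − θ₀)`.**  In the model the ground state `g` has mass `≤ 10⁻⁴` inside `|y| ≤ 1` (R40 (i)), so every
profile supported there — `btOmega_β` included — has quotient `≤ (10⁻⁴ + q_max)·Λ_top < 0.18·Λ_top` (`q_max = 3 − √8 = 0.172`, the largest one-mode Mehler ratio), whereas
`g·𝟙{1 < |y| ≤ ρ}` has quotient `≥ (1 − 10⁻⁴ − m(ρ))·Λ_top`, `m(ρ)` the mass of `g` outside `|y| ≤ ρ` (`m(2.1) ≈ 10⁻²`, R40 (iii)): a disjoint competitor with `σ' ≥ 5·btSlow`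
is what the model predicts, for every `θ₀`.  The missing link for an UNCONDITIONAL `¬hST` is therefore exactly ONE certified competitor,
  H(L,s): `∃ Ω' R' σ' κ'` as in §3 with `∀ᶠ β, btSlow L β ≤ σ' β` — e.g. `Ω'_β = frozenProfile L q (ρβ^{-1/2}) β · 𝟙{btRad β < ‖x‖}` with the Mehler form `q`, certified by
  re-running lane A's (B-T) pen at radius `ρβ^{-1/2}` and comparing the two constants `btC` by a two-sided Gaussian (Mehler) evaluation of `fpBOKernel(Ω, coreWeight)(1,1)`
  [Luscher1983 §3; SjostrandZworski2007 §2] —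
the next construction target of this seat (Disproof.lean §AM, HANDOFF cycle 34).  CLASS of the typed target `hST(btOmega, btSlow)` (provisional, conditional on H):
stub-misstated — repair: `Ω :=` the Mehler/Riccati Gaussian `frozenProfile L q r` with `q_β(x) = β·Σ b_k x_k²` in transverse normal modes and `r·β^{1/2} → ∞`
(`…BTFibreProfile` already carries the slot `q`), `σ` re-derived for that profile; the (B-T) engine survives verbatim for the repaired profile.
HONEST FRAMING: necessity bookkeeping (one test state, one weighted integral inequality, scalar algebra) about a stub (S-BASE, C4-CORE) of a child of the CONDITIONAL
reduction route R2b1 (bears on R2b1 only); nothing here refutes a landed file; not `¬TwistedTraceScaling`, not infinite volume, not a gap, not Clay.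

## References
* M. Lüscher, *Some analytic results concerning the mass spectrum of Yang–Mills gauge theories on a torus*, Nucl. Phys. B219 (1983) 233–261, §3. [Luscher1983]
* J. Sjöstrand, M. Zworski, *Elementary linear algebra for advanced spectral problems*, Ann. Inst. Fourier 57 (2007) 2095–2141, §2. [SjostrandZworski2007]
-/

set_option autoImplicit false

noncomputable section

open MeasureTheory Real Filter Topology
open scoped BigOperators
open Literature.MathematicalPhysics.QuantumFieldTheory hiding SU2
open Literature.MathematicalPhysics.QuantumLattice

namespace Summit.QuantumFields.YangMills.Theorems.TwistedTraceScaling.Negative.R41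

open Summit.QuantumFields.YangMills.Theorems.FemtoTransferGap
open Summit.QuantumFields.YangMills.Theorems.FemtoTransferGap.TwoLattice
open Summit.QuantumFields.YangMills.Theorems.FemtoTransferGap.TwoLattice.Avg
open Summit.QuantumFields.YangMills.Theorems.FemtoTransferGap.TwoLattice.ConstTube
open Summit.QuantumFields.YangMills.Theorems.FemtoTransferGap.TwoLattice.Stiff (LinkSpace)

variable {L : ℕ} [NeZero L]

/-! ## §1 Scalar endgame -/

/-- ★ The chain `σ'γ[(1−κ')e − κ']λ₀l ≤ T ≤ (1−θ₀)Sλ₀N ≤ (1−θ₀)(1+κ_N)Sγλ₀l`, divided by `γλ₀l > 0`. [folklore] -/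
theorem slow_ratio_le {σ' S γ Λ l Q T N κ' κN e θ₀ : ℝ} (hσ' : 0 ≤ σ') (hS : 0 ≤ S) (hγ : 0 < γ) (hΛ : 0 < Λ) (hl : 0 < l)
    (hκ'1 : κ' ≤ 1) (hθ₀ : θ₀ ≤ 1) (hQ : e * Λ * l ≤ Q) (hT : σ' * γ * Q - κ' * (σ' * γ) * (Q + Λ * l) ≤ T)
    (hST : T ≤ (1 - θ₀) * (S * Λ) * N) (hN : N ≤ (1 + κN) * γ * l) :
    σ' * ((1 - κ') * e - κ') ≤ (1 - θ₀) * (1 + κN) * S := by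
  have h1 : (1 - κ') * (σ' * γ) * (e * Λ * l) ≤ (1 - κ') * (σ' * γ) * Q :=
    mul_le_mul_of_nonneg_left hQ (mul_nonneg (by linarith) (mul_nonneg hσ' hγ.le))
  have h2 : (1 - θ₀) * (S * Λ) * N ≤ (1 - θ₀) * (S * Λ) * ((1 + κN) * γ * l) :=
    mul_le_mul_of_nonneg_left hN (mul_nonneg (by linarith) (mul_nonneg hS hΛ.le))
  have h3 : (γ * Λ * l) * (σ' * ((1 - κ') * e - κ')) ≤ (γ * Λ * l) * ((1 - θ₀) * (1 + κN) * S) := by linarith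
  exact le_of_mul_le_mul_left h3 (by positivity)

/-- ★ Cleanup: with `0 < ε ≤ 1`, `κ' ≤ ε/4`, `e ≥ 1 − ε/2`, `κ_N ≤ ε`: `(1 − ε)σ' ≤ (1 − θ₀)(1 + ε)S`. [folklore] -/
theorem slow_ratio_clean {σ' S κ' κN e θ₀ ε : ℝ} (hσ' : 0 ≤ σ') (hS : 0 ≤ S) (hθ₀ : θ₀ ≤ 1) (hε1 : ε ≤ 1)
    (hκ' : κ' ≤ ε / 4) (he : 1 - ε / 2 ≤ e) (hκN : κN ≤ ε)
    (h : σ' * ((1 - κ') * e - κ') ≤ (1 - θ₀) * (1 + κN) * S) :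
    (1 - ε) * σ' ≤ (1 - θ₀) * (1 + ε) * S := by
  have hprod : (1 - ε / 4) * (1 - ε / 2) ≤ (1 - κ') * e :=
    mul_le_mul (by linarith) he (by linarith) (by linarith)
  have hlow : 1 - ε ≤ (1 - κ') * e - κ' := by nlinarith [hprod, sq_nonneg ε]
  have h1 : (1 - ε) * σ' ≤ σ' * ((1 - κ') * e - κ') := by nlinarith
  have h2 : (1 - θ₀) * (1 + κN) * S ≤ (1 - θ₀) * (1 + ε) * S := by nlinarith [mul_nonneg (show (0:ℝ) ≤ 1 - θ₀ by linarith) hS]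
  linarith

/-- ★ No gap under dominance: `(1 − ε)σ' ≤ (1 − θ₀)(1 + ε)S`, `S ≤ Dσ'`, `σ' > 0`, `(1 − θ₀)D < 1`, `θ₀ ≤ 1` and `ε = (1 − (1−θ₀)D)/4` are contradictory. [folklore] -/
theorem no_gap_of_dominance {σ' S D θ₀ : ℝ} (hσ' : 0 < σ') (hθ₀ : θ₀ ≤ 1) (hD : (1 - θ₀) * D < 1) (hdom : S ≤ D * σ')
    (h : (1 - (1 - (1 - θ₀) * D) / 4) * σ' ≤ (1 - θ₀) * (1 + (1 - (1 - θ₀) * D) / 4) * S) : False := by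
  set c : ℝ := (1 - θ₀) * D with hc
  have hc1 : c < 1 := hD
  have h1 : (1 - θ₀) * (1 + (1 - c) / 4) * S ≤ (1 - θ₀) * (1 + (1 - c) / 4) * (D * σ') :=
    mul_le_mul_of_nonneg_left hdom (mul_nonneg (by linarith) (by linarith))
  have h2 : (1 - (1 - c) / 4) * σ' ≤ c * (1 + (1 - c) / 4) * σ' := by
    have : (1 - θ₀) * (1 + (1 - c) / 4) * (D * σ') = c * (1 + (1 - c) / 4) * σ' := by rw [hc]; ring
    linarith
  have h3 : 0 < (1 - (1 - c) / 4) - c * (1 + (1 - c) / 4) := by nlinarith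
  nlinarith

/-- The lower half of a two-sided (B-T) certificate of lane A's shape. [folklore] -/
theorem hT_lower_of_twoSided {T σ γ Q κ R : ℝ} (h : |T - σ * γ * Q| ≤ κ * (σ * γ) * R) : σ * γ * Q - κ * (σ * γ) * R ≤ T := by
  have := (abs_le.mp h).1; linarith

/-! ## §2 Fibre lemmas: disjoint profiles are fibrewise orthogonal; the one-sided fibre-mass brick at every fat factor -/

/-- ★ **Disjoint profiles are fibrewise `w`-orthogonal**: if `Ω'·Ω ≡ 0` then `fibreInner w Ω (boFun φ Ω') u = 0` for every weight `w`, amplitude `φ` and slow point `u`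
(the transverse measure is carried by the cap, where `boFun φ Ω' (orthoTube u v) = φ(u)Ω'(v̂)`). [folklore] -/
theorem fibreInner_boFun_eq_zero_of_disjoint (w : GaugeConfig 3 L SU2 → ℝ) {Ω Ω' : LinkSpace L → ℝ} (hdisj : ∀ x, Ω' x ≠ 0 → Ω x = 0)
    (φ : GaugeConfig 3 1 SU2 → ℝ) (u : GaugeConfig 3 1 SU2) : fibreInner L w Ω (boFun L φ Ω') u = 0 := by
  unfold fibreInner
  have hae : ∀ᵐ v ∂orthoTransverse L, v ∈ capBalancedSet L := by rw [ae_iff]; exact orthoTransverse_compl_capBalancedSet L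
  refine integral_eq_zero_of_ae (hae.mono fun v hv => ?_)
  show boFun L φ Ω' (orthoTube L u v) * Ω (linkEmbed L v) * w (orthoTube L u v) = (0 : (Edge 3 L → Fin 3 → ℝ) → ℝ) v
  rw [boFun_orthoTube L φ Ω' u hv]
  by_cases h0 : Ω' (linkEmbed L v) = 0
  · rw [h0]; simp
  · rw [hdisj _ h0]; simp

/-- `0 ≤ fibreMass w Ω u` for a nonnegative weight. [folklore] -/
theorem fibreMass_nonneg {w : GaugeConfig 3 L SU2 → ℝ} (hw0 : ∀ U, 0 ≤ w U) (Ω : LinkSpace L → ℝ) (u : GaugeConfig 3 1 SU2) : 0 ≤ fibreMass L w Ω u := by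
  unfold fibreMass; exact integral_nonneg fun v => mul_nonneg (sq_nonneg _) (hw0 _)

/-- ★ **ONE-SIDED FIBRE-MASS BRICK**: `χ = 𝟙_F·e^{−gaugeCoordSq/δg²}` with `0 ≤ χ ≤ 1`, `gaugeAvg χ ≤ N⁺` on `F`, `Ω` bounded measurable with norm-bounded support, every
fibre point through `supp Ω` (on the cap) in `F` ⇒ `fibreMass (N/χ) Ω u ≤ boGamma Ω δg N⁺` — the two-sided brick `…FibreMassBrick.fibreMass_brick` at `N̄ = N⁺/2`, `κ = 1`
(its lower half is then `0 ≤ gaugeAvg χ`), and linearity of `boGamma` in `N̄`. [cite: Luscher1983, §3] -/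
theorem fibreMass_le_of_gaugeAvg_le {F : Set (GaugeConfig 3 L SU2)} {δg : ℝ} {χ : GaugeConfig 3 L SU2 → ℝ}
    (hχ : ∀ U, χ U = F.indicator (fun _ => (1 : ℝ)) U * Real.exp (-(gaugeCoordSq L U / δg ^ 2))) (hχm : Measurable χ)
    (hχ0 : ∀ U, 0 ≤ χ U) (hχ1 : ∀ U, χ U ≤ 1) {Nup : ℝ} (hN : ∀ U ∈ F, gaugeAvg χ U ≤ Nup)
    {Ω : LinkSpace L → ℝ} (hΩ : Measurable Ω) {CΩ : ℝ} (hCΩ : ∀ x, |Ω x| ≤ CΩ) {R : ℝ} (hΩR : ∀ x, Ω x ≠ 0 → ‖x‖ ≤ R)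
    {u : GaugeConfig 3 1 SU2} (hu : ∀ v ∈ capBalancedSet L, Ω (linkEmbed L v) ≠ 0 → orthoTube L u v ∈ F) :
    fibreMass L (softWeight χ) Ω u ≤ boGamma L Ω δg Nup := by
  have hN' : ∀ U ∈ F, Nup / 2 * (1 - 1) ≤ gaugeAvg χ U ∧ gaugeAvg χ U ≤ Nup / 2 * (1 + 1) := fun U hU =>
    ⟨by rw [sub_self, mul_zero]; exact (gaugeAvg_mem_Icc hχm hχ0 hχ1 U).1, by linarith [hN U hU]⟩
  have h := (abs_le.mp (fibreMass_brick hχ hχm hN' hΩ hCΩ hΩR hu)).2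
  have hlin : boGamma L Ω δg Nup = 2 * boGamma L Ω δg (Nup / 2) := by unfold boGamma; ring
  rw [hlin]; linarith

/-- The record fat tubes increase with the fat factor. [folklore] -/
theorem fatTubeRho_recordChi_mono {s K M M' : ℝ} (hK : 0 ≤ K) (hMM' : M ≤ M') (β : ℝ) :
    fatTubeRho L (fun β => K * powScale s β) (fun b => M * (K * powScale s b)) β ⊆
      fatTubeRho L (fun β => K * powScale s β) (fun b => M' * (K * powScale s b)) β := by
  intro V hV
  have h : M * (K * powScale s β) ≤ M' * (K * powScale s β) := mul_le_mul_of_nonneg_right hMM' (mul_nonneg hK (powScale_pos s β).le)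
  exact ⟨fun e => lt_of_lt_of_le (hV.1 e) h, hV.2⟩

/-- The record weight increases with the fat factor: `recordChi L s K M β ≤ recordChi L s K M' β` for `M ≤ M'` (`K ≥ 0`). [folklore] -/
theorem recordChi_mono {s K M M' : ℝ} (hK : 0 ≤ K) (hMM' : M ≤ M') (β : ℝ) (U : GaugeConfig 3 L SU2) :
    recordChi L s K M β U ≤ recordChi L s K M' β U := by
  unfold recordChi recordWeightRho
  exact mul_le_mul_of_nonneg_right (Set.indicator_le_indicator_of_subset (fatTubeRho_recordChi_mono hK hMM' β) (fun _ => zero_le_one) U) (Real.exp_pos _).le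

/-- ★ **The upper half of (P) at EVERY fat factor `M`** (`L` with a nonzero site, `0 < s ≤ 1/3`): `gaugeAvg (recordChi L s 43 M β) ≤ N̄_β·(1 + C·(43β^{-s})²)` on the fat tube
of factor `M`, eventually — from `fpWeight_core_constant` at `max M M₀` and monotonicity in `M`. [cite: Luscher1983, §3] -/
theorem gaugeAvg_recordChi_le (hL : Nonempty (NzSite L)) {s : ℝ} (hs : 0 < s) (hs3 : s ≤ 1 / 3) (M : ℝ) :
    ∃ C : ℝ, 0 ≤ C ∧ ∀ᶠ β : ℝ in atTop, ∀ U ∈ fatTubeRho L (fun β => 43 * powScale s β) (fun b => M * (43 * powScale s b)) β,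
      gaugeAvg (recordChi L s 43 M β) U ≤ fpWeightBar L (powScale 1 β) * (1 + C * (43 * powScale s β) ^ 2) := by
  have hδ0 : ∀ β, 0 < 43 * powScale s β := fun β => mul_pos (by norm_num) (powScale_pos s β)
  have hδt : Tendsto (fun β => 43 * powScale s β) atTop (𝓝 0) := by
    have := (tendsto_powScale hs).const_mul 43; simpa using this
  have hsd : ∀ᶠ β in atTop, 0 < powScale 1 β ∧ powScale 1 β ≤ (43 * powScale s β) ^ 3 := by
    filter_upwards [Filter.eventually_ge_atTop (1 : ℝ)] with β hβ
    refine ⟨powScale_pos 1 β, (powScale_one_le_cube hs3 hβ).trans ?_⟩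
    have hp := powScale_pos s β
    exact pow_le_pow_left₀ hp.le (by nlinarith) 3
  obtain ⟨M₀, -, hPM⟩ := fpWeight_core_constant L hL hδ0 hδt hsd
  obtain ⟨C, β₀, hC, hP⟩ := hPM (max M M₀) (le_max_right _ _)
  refine ⟨C, hC, ?_⟩
  filter_upwards [eventually_ge_atTop β₀] with β hβ U hU
  have hmono : gaugeAvg (recordChi L s 43 M β) U ≤ gaugeAvg (recordChi L s 43 (max M M₀) β) U :=
    gaugeAvg_mono (recordChi_props s 43 M β).1 (recordChi_props s 43 (max M M₀) β).1 (recordChi_props s 43 M β).2.1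
      (recordChi_props s 43 (max M M₀) β).2.1 (fun V => recordChi_mono (by norm_num) (le_max_left M M₀) β V) U
  exact hmono.trans (hP β hβ U (fatTubeRho_recordChi_mono (by norm_num) (le_max_left M M₀) β hU)).2

/-- ★ **Fibre mass of a profile against the record weight, upper bound**: over a slow point `u` with `orbitDist u ≤ δ₁`, a profile `Ω ⊆ {‖x‖ ≤ r}`, `r ≤ 1/2`, `|Ω| ≤ 1`,
with `4r + δ₁ < M·43β^{-s}` and `|Edge|(4r + δ₁) < 43β^{-s}`, and the upper half of (P) with constant `C`:
`fibreMass (softWeight (recordChi L s 43 M β)) Ω u ≤ boGamma Ω β^{-1} (N̄_β(1 + C(43β^{-s})²))`. [cite: Luscher1983, §3] -/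
theorem fibreMass_recordChi_le {s M β C : ℝ}
    (hP : ∀ U ∈ fatTubeRho L (fun β => 43 * powScale s β) (fun b => M * (43 * powScale s b)) β,
      gaugeAvg (recordChi L s 43 M β) U ≤ fpWeightBar L (powScale 1 β) * (1 + C * (43 * powScale s β) ^ 2))
    {Ω : LinkSpace L → ℝ} (hΩ : Measurable Ω) (hΩ1 : ∀ x, |Ω x| ≤ 1) {r : ℝ} (hΩr : ∀ x, Ω x ≠ 0 → ‖x‖ ≤ r) (hr : r ≤ 1 / 2)
    {δ₁ : ℝ} (hρ : 4 * r + δ₁ < M * (43 * powScale s β)) (hrad : Fintype.card (Edge 3 L) * (4 * r + δ₁) < 43 * powScale s β)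
    {u : GaugeConfig 3 1 SU2} (hu : orbitDist u ≤ δ₁) :
    fibreMass L (softWeight (recordChi L s 43 M β)) Ω u ≤ boGamma L Ω (powScale 1 β) (fpWeightBar L (powScale 1 β) * (1 + C * (43 * powScale s β) ^ 2)) := by
  have hfib : ∀ v ∈ capBalancedSet L, Ω (linkEmbed L v) ≠ 0 →
      orthoTube L u v ∈ fatTubeRho L (fun β => 43 * powScale s β) (fun b => M * (43 * powScale s b)) β :=
    fun v _ hv => orthoTube_mem_fatTubeRho (δ' := fun β => 43 * powScale s β) (ρ := fun b => M * (43 * powScale s b)) hu hr hΩr hρ hrad v hv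
  exact fibreMass_le_of_gaugeAvg_le (F := fatTubeRho L (fun β => 43 * powScale s β) (fun b => M * (43 * powScale s b)) β) (δg := powScale 1 β)
    (fun _ => rfl) (recordChi_props s 43 M β).1 (recordChi_props s 43 M β).2.2.1 (fun U => (abs_le.mp ((recordChi_props s 43 M β).2.1 U)).2) hP hΩ hΩ1 hΩr hfib

/-- ★ **`‖boFun φ Ω‖²_w ≤ G·‖φ‖²`** when `fibreMass w Ω u ≤ G` over every slow point `u` in the support of `φ` (bounded measurable data, `w ≥ 0`). [folklore] -/
theorem tubeNormSq_boFun_le {φ : GaugeConfig 3 1 SU2 → ℝ} (hφ : Measurable φ) {Cφ : ℝ} (hCφ : ∀ u, |φ u| ≤ Cφ) {Ω : LinkSpace L → ℝ} (hΩ : Measurable Ω)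
    {CΩ : ℝ} (hCΩ : ∀ x, |Ω x| ≤ CΩ) {w : GaugeConfig 3 L SU2 → ℝ} (hw : Measurable w) {Cw : ℝ} (hCw : ∀ U, |w U| ≤ Cw) (hw0 : ∀ U, 0 ≤ w U)
    {G : ℝ} (hG : ∀ u, φ u ≠ 0 → fibreMass L w Ω u ≤ G) :
    tubeNormSq w (boFun L φ Ω) ≤ G * l2 φ φ := by
  rw [tubeNormSq_boFun hφ hCφ hΩ hCΩ hw hCw, l2_self_eq_integral_sq, ← integral_const_mul]
  refine integral_mono_of_nonneg (ae_of_all _ fun u => mul_nonneg (sq_nonneg _) (fibreMass_nonneg hw0 Ω u)) ?_ (ae_of_all _ fun u => ?_)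
  · exact (integrable_of_measurable_abs_le _ (hφ.pow_const 2) (C := Cφ ^ 2) fun u => by
      rw [abs_pow]; exact pow_le_pow_left₀ (abs_nonneg _) (hCφ u) 2).const_mul G
  · by_cases h0 : φ u = 0
    · simp [h0]
    · show φ u ^ 2 * fibreMass L w Ω u ≤ G * φ u ^ 2
      nlinarith [hG u h0, sq_nonneg (φ u)]

/-! ## §3 ★★★ The necessity: a stiff gap for `(btOmega, btSlow)` forces `btSlow` to dominate every certified disjoint competitor -/

/-- ★★★ **SLOW-FACTOR DOMINANCE NECESSITY.**  For `L` with a nonzero site and `0 < s < 1/5`: let `Ω'` (radius `R'`, slow factor `σ'`, rate `κ' → 0`) be a fibre profile family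
DISJOINT from `btOmega L` and carrying the one-sided (B-T) certificate on the window `{orbitDist < recordDelta1 L s β}`.  If lane A's (B-ST) hypothesis `hST` for
`(btOmega L, btSlow L)` holds with gap `θ₀ ≤ 1` at a fat factor `M ≥ 1`, then for every `ε > 0`, eventually `(1 − ε)·σ' β ≤ (1 − θ₀)·(1 + ε)·btSlow L β`.
[cite: Luscher1983, §3] [cite: SjostrandZworski2007, §2] -/
theorem btSlow_dominates_of_stiff_gap (hL : Nonempty (NzSite L)) {s : ℝ} (hs : 0 < s) (hs5 : s < 1 / 5)
    {Ω' : ℝ → LinkSpace L → ℝ} {R' σ' κ' : ℝ → ℝ}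
    (hΩ'm : ∀ β, Measurable (Ω' β)) (hΩ'1 : ∀ β x, |Ω' β x| ≤ 1) (hΩ'r : ∀ β x, Ω' β x ≠ 0 → ‖x‖ ≤ R' β)
    (hR' : ∀ β, 0 ≤ R' β ∧ R' β ≤ 1 / 2) (hR'small : ∀ᶠ β in atTop, 12 * Fintype.card (Site 3 L) * R' β < powScale s β)
    (hdisj : ∀ β x, Ω' β x ≠ 0 → btOmega L β x = 0)
    (hγ' : ∀ᶠ β in atTop, 0 < recordGamma L Ω' β) (hσ' : ∀ᶠ β in atTop, 0 < σ' β) (hκ' : Tendsto κ' atTop (𝓝 0))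
    (hT' : ∀ᶠ β in atTop, ∀ φ : GaugeConfig 3 1 SU2 → ℝ, Measurable φ → (∃ C : ℝ, ∀ u, |φ u| ≤ C) →
      (∀ (g : Site 3 1 → SU2) (u : GaugeConfig 3 1 SU2), φ (gaugeTransform g u) = φ u) → (∀ u, φ u ≠ 0 → orbitDist u < recordDelta1 L s β) →
      σ' β * recordGamma L Ω' β * qform su2Rep ((L : ℝ) ^ 3 * β) φ φ
        - κ' β * (σ' β * recordGamma L Ω' β) * (qform su2Rep ((L : ℝ) ^ 3 * β) φ φ + levelValue su2Rep 1 ((L : ℝ) ^ 3 * β) 0 * l2 φ φ)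
        ≤ tubeForm β (boFun L φ (Ω' β)))
    {M : ℝ} (hM : 1 ≤ M) {θ₀ : ℝ} (hθ₀ : θ₀ ≤ 1)
    (hST : ∀ᶠ β in atTop, ∀ v : GaugeConfig 3 L SU2 → ℝ, Measurable v → (∃ C : ℝ, ∀ U, |v U| ≤ C) → (∀ U, v U ≠ 0 → recordChi L s 43 M β U ≠ 0) →
      (∀ u, fibreInner L (softWeight (recordChi L s 43 M β)) (btOmega L β) v u = 0) →
      tubeForm β v ≤ (1 - θ₀) * (btSlow L β * levelValue su2Rep 1 ((L : ℝ) ^ 3 * β) 0) * tubeNormSq (softWeight (recordChi L s 43 M β)) v) :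
    ∀ ε : ℝ, 0 < ε → ∀ᶠ β in atTop, (1 - ε) * σ' β ≤ (1 - θ₀) * (1 + ε) * btSlow L β := by
  intro ε hε
  -- WLOG `ε ≤ 1`
  set ε₁ : ℝ := min ε 1 with hε₁def
  have hε₁ : 0 < ε₁ := lt_min hε one_pos
  have hε₁1 : ε₁ ≤ 1 := min_le_right _ _
  have hε₁ε : ε₁ ≤ ε := min_le_left _ _
  have hε4 : ε₁ / 4 ≤ 1 := by linarith only [hε₁1]
  have hε2 : 0 ≤ ε₁ / 2 := by linarith only [hε₁]
  -- (P), upper half, at the fat factor `M`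
  obtain ⟨C, hC, hP⟩ := gaugeAvg_recordChi_le hL hs (by linarith only [hs5]) M
  -- the near-top one-site amplitude at slack `ε₁/2`
  obtain ⟨B₀, hB₀⟩ := exists_localized_near_top (ε₁ / 2) (by linarith only [hε₁])
  -- the rates
  have hκN : Tendsto (fun β => C * (43 * powScale s β) ^ 2) atTop (𝓝 0) := by
    have := (((tendsto_powScale hs).const_mul 43).pow 2).const_mul C; simpa using this
  have hL1 : (1 : ℝ) ≤ (L : ℝ) := by exact_mod_cast NeZero.one_le
  have hL3 : (1 : ℝ) ≤ (L : ℝ) ^ 3 := one_le_pow₀ hL1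
  have hcard1 : (1 : ℝ) ≤ Fintype.card (Edge 3 L) := by
    have : 0 < Fintype.card (Edge 3 L) := Fintype.card_pos_iff.mpr ⟨((fun _ => 0), 0)⟩
    exact_mod_cast this
  filter_upwards [radii_recordDelta1 hR'small, core_lt_recordDelta1 (L := L) hs hs5, hγ', hσ', hT', hST, hP,
    hκ'.eventually (ge_mem_nhds (show (0 : ℝ) < ε₁ / 4 by linarith only [hε₁])), hκN.eventually (ge_mem_nhds hε₁),
    eventually_ge_atTop (max B₀ 2)] with β hrad hcore hγβ hσβ hTβ hSTβ hPβ hκ'β hκNβ hβ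
  have hβ2 : 2 ≤ β := (le_max_right _ _).trans hβ
  have hβ0 : 0 ≤ β := by linarith only [hβ2]
  -- the slow scale `B = L³β ≥ max(B₀, 2)`
  have hBβ : β ≤ (L : ℝ) ^ 3 * β := le_mul_of_one_le_left hβ0 hL3
  have hB : B₀ ≤ (L : ℝ) ^ 3 * β := ((le_max_left _ _).trans hβ).trans hBβ
  have hB2 : 2 ≤ (L : ℝ) ^ 3 * β := hβ2.trans hBβ
  have hB1 : 1 ≤ (L : ℝ) ^ 3 * β := by linarith only [hB2]
  obtain ⟨φ, hφm, ⟨Cφ, hCφ⟩, hφg, hφsupp, hl2, hQ⟩ := hB₀ ((L : ℝ) ^ 3 * β) hB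
  have hφδ : ∀ u, φ u ≠ 0 → orbitDist u < recordDelta1 L s β := fun u hu => (hφsupp u hu).trans hcore
  -- positivity of the top value and of the slow factor of record
  have hΛ : 0 < levelValue su2Rep 1 ((L : ℝ) ^ 3 * β) 0 :=
    lt_of_lt_of_le (mul_pos (uniformFloorConst_pos (L := 1)) (latCE_pos (L := 1) (by linarith only [hB1])))
      (levelValue_zero_ge_uniform (L := 1) hB1)
  have hS : 0 ≤ btSlow L β := (btSlow_pos hβ0).le
  -- the radii
  have hr := hR' β
  have hδ₁0 : 0 < recordDelta1 L s β := by
    unfold recordDelta1; exact div_pos (mul_pos (by norm_num) (powScale_pos s β)) card_site_pos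
  have hpos : 0 ≤ 4 * R' β + recordDelta1 L s β := by linarith only [hr.1, hδ₁0]
  have hρ : 4 * R' β + recordDelta1 L s β < M * (43 * powScale s β) :=
    lt_of_le_of_lt (le_mul_of_one_le_left hpos hcard1) (hrad.trans_le (le_mul_of_one_le_left (mul_pos (by norm_num) (powScale_pos s β)).le hM))
  -- the test state `v = boFun φ Ω'_β`
  obtain ⟨hwm, hwb, hw0, -⟩ := softWeight_recordChi_props (L := L) s 43 M β
  have hvm : Measurable (boFun L φ (Ω' β)) := measurable_boFun L hφm (hΩ'm β)
  have hvb : ∀ U, |boFun L φ (Ω' β) U| ≤ Cφ * 1 := abs_boFun_le L hCφ (hΩ'1 β)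
  have hvsupp : ∀ U, boFun L φ (Ω' β) U ≠ 0 → recordChi L s 43 M β U ≠ 0 := fun U hU =>
    (boFun_support_record (δ' := fun β => 43 * powScale s β) (ρ := fun b => M * (43 * powScale s b)) (δg := powScale 1)
      hφδ hr.2 (hΩ'r β) hρ hrad hU).1
  have horth : ∀ u, fibreInner L (softWeight (recordChi L s 43 M β)) (btOmega L β) (boFun L φ (Ω' β)) u = 0 :=
    fun u => fibreInner_boFun_eq_zero_of_disjoint _ (hdisj β) φ u
  have hSTv := hSTβ _ hvm ⟨_, hvb⟩ hvsupp horth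
  have hTφ := hTβ φ hφm ⟨Cφ, hCφ⟩ hφg hφδ
  -- the norm of the test state
  have hG : ∀ u, φ u ≠ 0 → fibreMass L (softWeight (recordChi L s 43 M β)) (Ω' β) u ≤ (1 + C * (43 * powScale s β) ^ 2) * recordGamma L Ω' β := by
    intro u hu
    have h := fibreMass_recordChi_le hPβ (hΩ'm β) (hΩ'1 β) (hΩ'r β) hr.2 hρ hrad (hφδ u hu).le
    refine h.trans_eq ?_
    unfold recordGamma boGamma; ring
  have hN := tubeNormSq_boFun_le hφm hCφ (hΩ'm β) (hΩ'1 β) hwm hwb hw0 hG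
  -- the exponential slack
  have hlam := bareLambda_pos_le_one hB2
  have he : 1 - ε₁ / 2 ≤ Real.exp (-(ε₁ / 2 * bareLambda ((L : ℝ) ^ 3 * β))) := by
    have h1 := Real.add_one_le_exp (-(ε₁ / 2 * bareLambda ((L : ℝ) ^ 3 * β)))
    have h2 := mul_le_of_le_one_right hε2 hlam.2
    linarith only [h1, h2]
  -- endgame
  have hmain := slow_ratio_le hσβ.le hS hγβ hΛ hl2 (hκ'β.trans hε4) hθ₀ hQ hTφ hSTv hN
  have hclean := slow_ratio_clean hσβ.le hS hθ₀ hε₁1 hκ'β he hκNβ hmain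
  have h1 : (1 - ε) * σ' β ≤ (1 - ε₁) * σ' β := mul_le_mul_of_nonneg_right (by linarith only [hε₁ε]) hσβ.le
  have h2 : (1 - θ₀) * (1 + ε₁) * btSlow L β ≤ (1 - θ₀) * (1 + ε) * btSlow L β :=
    mul_le_mul_of_nonneg_right (mul_le_mul_of_nonneg_left (by linarith only [hε₁ε]) (by linarith only [hθ₀])) hS
  exact h1.trans (hclean.trans h2)

/-! ## §4 ★★★ A certified dominant competitor refutes (B-ST) of record for every gap and every fat factor -/

/-- ★★★ **(B-ST) OF RECORD IS FALSE GIVEN A COMPETITOR WITH `btSlow ≤ D·σ'`, `(1 − θ₀)D < 1`.**  Same data as `btSlow_dominates_of_stiff_gap`; if moreover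
`btSlow L β ≤ D·σ' β` eventually and `(1 − θ₀)·D < 1`, `θ₀ ≤ 1`, then lane A's hypothesis `hST(btOmega L, btSlow L, θ₀, M)` is false for every `M ≥ 1`.
[cite: Luscher1983, §3] [cite: SjostrandZworski2007, §2] -/
theorem btStiffGap_false_of_competitor (hL : Nonempty (NzSite L)) {s : ℝ} (hs : 0 < s) (hs5 : s < 1 / 5)
    {Ω' : ℝ → LinkSpace L → ℝ} {R' σ' κ' : ℝ → ℝ}
    (hΩ'm : ∀ β, Measurable (Ω' β)) (hΩ'1 : ∀ β x, |Ω' β x| ≤ 1) (hΩ'r : ∀ β x, Ω' β x ≠ 0 → ‖x‖ ≤ R' β)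
    (hR' : ∀ β, 0 ≤ R' β ∧ R' β ≤ 1 / 2) (hR'small : ∀ᶠ β in atTop, 12 * Fintype.card (Site 3 L) * R' β < powScale s β)
    (hdisj : ∀ β x, Ω' β x ≠ 0 → btOmega L β x = 0)
    (hγ' : ∀ᶠ β in atTop, 0 < recordGamma L Ω' β) (hσ' : ∀ᶠ β in atTop, 0 < σ' β) (hκ' : Tendsto κ' atTop (𝓝 0))
    (hT' : ∀ᶠ β in atTop, ∀ φ : GaugeConfig 3 1 SU2 → ℝ, Measurable φ → (∃ C : ℝ, ∀ u, |φ u| ≤ C) →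
      (∀ (g : Site 3 1 → SU2) (u : GaugeConfig 3 1 SU2), φ (gaugeTransform g u) = φ u) → (∀ u, φ u ≠ 0 → orbitDist u < recordDelta1 L s β) →
      σ' β * recordGamma L Ω' β * qform su2Rep ((L : ℝ) ^ 3 * β) φ φ
        - κ' β * (σ' β * recordGamma L Ω' β) * (qform su2Rep ((L : ℝ) ^ 3 * β) φ φ + levelValue su2Rep 1 ((L : ℝ) ^ 3 * β) 0 * l2 φ φ)
        ≤ tubeForm β (boFun L φ (Ω' β)))
    {D : ℝ} (hdom : ∀ᶠ β in atTop, btSlow L β ≤ D * σ' β)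
    {M : ℝ} (hM : 1 ≤ M) {θ₀ : ℝ} (hθ₀ : θ₀ ≤ 1) (hD : (1 - θ₀) * D < 1) :
    ¬ (∀ᶠ β in atTop, ∀ v : GaugeConfig 3 L SU2 → ℝ, Measurable v → (∃ C : ℝ, ∀ U, |v U| ≤ C) → (∀ U, v U ≠ 0 → recordChi L s 43 M β U ≠ 0) →
      (∀ u, fibreInner L (softWeight (recordChi L s 43 M β)) (btOmega L β) v u = 0) →
      tubeForm β v ≤ (1 - θ₀) * (btSlow L β * levelValue su2Rep 1 ((L : ℝ) ^ 3 * β) 0) * tubeNormSq (softWeight (recordChi L s 43 M β)) v) := by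
  intro hST
  have hε : 0 < (1 - (1 - θ₀) * D) / 4 := by linarith
  have hev := btSlow_dominates_of_stiff_gap hL hs hs5 hΩ'm hΩ'1 hΩ'r hR' hR'small hdisj hγ' hσ' hκ' hT' hM hθ₀ hST _ hε
  obtain ⟨β, h, hdomβ, hσβ⟩ := (hev.and (hdom.and hσ')).exists
  exact no_gap_of_dominance hσβ hθ₀ hD hdomβ h

/-- ★★★ **A CERTIFIED DISJOINT COMPETITOR WITH `σ' ≥ btSlow` REFUTES (B-ST) OF RECORD FOR EVERY `θ₀ ∈ (0,1]` AND EVERY FAT FACTOR `M ≥ 1`** — the hypothesis `hST` of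
`…BTRecord.recordAnalyticInput_of_stiff_offDiag` and of `…BTRecord.innerNoIntruderOneOrbitAt_of_stiff_offDiag` is then unsatisfiable (`D = 1` in
`btStiffGap_false_of_competitor`).  The competitor is the open construction target H of the module docstring. [cite: Luscher1983, §3] [cite: SjostrandZworski2007, §2] -/
theorem btStiffGap_false_of_dominant_competitor (hL : Nonempty (NzSite L)) {s : ℝ} (hs : 0 < s) (hs5 : s < 1 / 5)
    {Ω' : ℝ → LinkSpace L → ℝ} {R' σ' κ' : ℝ → ℝ}
    (hΩ'm : ∀ β, Measurable (Ω' β)) (hΩ'1 : ∀ β x, |Ω' β x| ≤ 1) (hΩ'r : ∀ β x, Ω' β x ≠ 0 → ‖x‖ ≤ R' β)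
    (hR' : ∀ β, 0 ≤ R' β ∧ R' β ≤ 1 / 2) (hR'small : ∀ᶠ β in atTop, 12 * Fintype.card (Site 3 L) * R' β < powScale s β)
    (hdisj : ∀ β x, Ω' β x ≠ 0 → btOmega L β x = 0)
    (hγ' : ∀ᶠ β in atTop, 0 < recordGamma L Ω' β) (hσ' : ∀ᶠ β in atTop, 0 < σ' β) (hκ' : Tendsto κ' atTop (𝓝 0))
    (hT' : ∀ᶠ β in atTop, ∀ φ : GaugeConfig 3 1 SU2 → ℝ, Measurable φ → (∃ C : ℝ, ∀ u, |φ u| ≤ C) →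
      (∀ (g : Site 3 1 → SU2) (u : GaugeConfig 3 1 SU2), φ (gaugeTransform g u) = φ u) → (∀ u, φ u ≠ 0 → orbitDist u < recordDelta1 L s β) →
      σ' β * recordGamma L Ω' β * qform su2Rep ((L : ℝ) ^ 3 * β) φ φ
        - κ' β * (σ' β * recordGamma L Ω' β) * (qform su2Rep ((L : ℝ) ^ 3 * β) φ φ + levelValue su2Rep 1 ((L : ℝ) ^ 3 * β) 0 * l2 φ φ)
        ≤ tubeForm β (boFun L φ (Ω' β)))
    (hdom : ∀ᶠ β in atTop, btSlow L β ≤ σ' β)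
    {M : ℝ} (hM : 1 ≤ M) {θ₀ : ℝ} (hθ₀ : 0 < θ₀ ∧ θ₀ ≤ 1) :
    ¬ (∀ᶠ β in atTop, ∀ v : GaugeConfig 3 L SU2 → ℝ, Measurable v → (∃ C : ℝ, ∀ U, |v U| ≤ C) → (∀ U, v U ≠ 0 → recordChi L s 43 M β U ≠ 0) →
      (∀ u, fibreInner L (softWeight (recordChi L s 43 M β)) (btOmega L β) v u = 0) →
      tubeForm β v ≤ (1 - θ₀) * (btSlow L β * levelValue su2Rep 1 ((L : ℝ) ^ 3 * β) 0) * tubeNormSq (softWeight (recordChi L s 43 M β)) v) :=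
  btStiffGap_false_of_competitor hL hs hs5 hΩ'm hΩ'1 hΩ'r hR' hR'small hdisj hγ' hσ' hκ' hT' (D := 1)
    (by filter_upwards [hdom] with β h; linarith) hM hθ₀.2 (by linarith [hθ₀.1])

end Summit.QuantumFields.YangMills.Theorems.TwistedTraceScaling.Negative.R41

end
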